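import Literature.Probability.Percolation.FiveMarkedLoopStubs
import HarnessLib

/-!
# The five-marked loop lemma, II: reach, the crossing identifications, and the lemma for every domain

Topic `Literature/Probability/Percolation`; proofs (pcv-sawmu b-engine-2 g5), for EVERY `D : TriMarkedDomain 5`:
* `loopReach_holds` (MatchA ∨ MatchB): Bollobás–Riordan's oriented interface walk (tree `TriDiscInterface`) run on
  `D.forget r` is an `IStep`-chain from the corner face `y_{r+1}` (`isCornerFace_startFace`) to `y_{r+2}` or `y_{r+4}`
  (`terminal_typeII`, `typeII_corner`); the colour bridge `bdryCol_forget` / `vcol_forget` identifies the tree's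
  4-marked colouring of `D.forget r` with `arcColour r false`;
* the tree's side invariants REFINED (`ExitInv'`/`EntryInv'` on any `TriMarkedDomain 4`: the black half escapes only to
  an open crossing `A₀ ↔ A₂`, the white half only to a closed crossing `A₁ ↔ A₃`; `exitInv'_succ`, `exitInv'_succ_succ`,
  `exitInv'_of_entryInv'`, `entryInv'_oppFace`, `exitInv'_startFace` repeat the tree's proofs with the escapes kept
  apart; `crossing_of_terminal`), whence `walk_dichotomy`;
* `matchBOpen_holds`, `matchAClosed_holds` (the cross case is killed by `loopUnique_holds`), and the assembly
  `fiveMarkedLoopLemma_holds : ∀ D, FiveMarkedLoopLemma D`, `fiveMarkedLoopLemma'_holds`, `fiveMarkedLoopLemmaFin_holds`.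

Status in print: Khristoforov–Smirnov 2021 §1.2 Lemma 2 / Bollobás–Riordan 2006 Ch. 7 Lemma 5 per corner of a
five-marked discrete domain — printed statement, first kernel text for all finite domains (consolidation-grade).

## References
* M. Khristoforov, S. Smirnov, *Percolation and O(1) loop model*, arXiv:2111.15612 (2021), §1.2 (Def. 3, Lemma 2, Lemma 4).
* B. Bollobás, O. Riordan, *Percolation*, Cambridge University Press (2006), Ch. 7 §7.2.2 pp. 168–171 (Lemma 5, Fig. 9).
-/

open Finset

namespace Literature.Probability.Percolation.FivePoint

open Literature.Probability.Percolation Literature.Probability.LatticeModels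

variable (D : TriMarkedDomain 5)

/-! ### LoopReach: the tree's oriented interface walk on `D.forget r` is an `IStep`-chain from `y_{r+1}`
to `y_{r+2}` or `y_{r+4}` -/

/-- the stretches of `D.forget r` (tree, by cases on `r`). [cite: BollobasRiordan2006, Ch. 7 Lemma 5 pp. 169–171] -/
theorem forget_stretches (r : Fin 5) :
    (D.forget r).stretch 0 = D.stretch (r + 1) ∧ (D.forget r).stretch 1 = D.stretch (r + 2) ∧
      (D.forget r).stretch 2 = D.stretch (r + 3) ∧ (D.forget r).stretch 3 = D.stretch (r + 4) ∪ D.stretch r := by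
  fin_cases r
  · exact ⟨D.forget_zero_stretch_zero, D.forget_zero_stretch_one, D.forget_zero_stretch_two, D.forget_zero_stretch_three⟩
  · exact ⟨D.forget_one_stretch_zero, D.forget_one_stretch_one, D.forget_one_stretch_two, D.forget_one_stretch_three⟩
  · exact ⟨D.forget_two_stretch_zero, D.forget_two_stretch_one, D.forget_two_stretch_two, D.forget_two_stretch_three⟩
  · exact ⟨D.forget_three_stretch_zero, D.forget_three_stretch_one, D.forget_three_stretch_two, D.forget_three_stretch_three⟩
  · exact ⟨D.forget_four_stretch_zero, D.forget_four_stretch_one, D.forget_four_stretch_two, D.forget_four_stretch_three⟩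

/-- a boundary dart lies in the `D.forget r`-stretch of its `D.forget r`-index (tree, `k = 4`). [cite: BollobasRiordan2006, Ch. 7 Lemma 5 pp. 169–171] -/
theorem mem_forget_stretch (r : Fin 5) {d : Site 2 × Site 2} (hd : d ∈ triBdryDarts D.verts) :
    d ∈ (D.forget r).stretch ((D.forget r).stretchIdx ((D.forget r).dpos d)) := by
  have := (D.forget r).iter_mem_stretch ((D.forget r).dpos d)
  rwa [(D.forget r).iter_dpos hd] at this

/-- **from `D.forget r`-stretches to `D`-indices.** [cite: BollobasRiordan2006, Ch. 7 Lemma 5 pp. 169–171] -/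
theorem posIdx_of_mem_forget_stretch (r : Fin 5) {d : Site 2 × Site 2} {i' : Fin 4} (h : d ∈ (D.forget r).stretch i') :
    (i' = 0 → posIdx D (D.dpos d) = r + 1) ∧ (i' = 1 → posIdx D (D.dpos d) = r + 2) ∧
      (i' = 2 → posIdx D (D.dpos d) = r + 3) ∧ (i' = 3 → posIdx D (D.dpos d) = r + 4 ∨ posIdx D (D.dpos d) = r) := by
  obtain ⟨h0, h1, h2, h3⟩ := forget_stretches D r
  refine ⟨?_, ?_, ?_, ?_⟩ <;> rintro rfl
  · rw [h0] at h; exact (posIdx_dpos_of_mem_stretch D h).2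
  · rw [h1] at h; exact (posIdx_dpos_of_mem_stretch D h).2
  · rw [h2] at h; exact (posIdx_dpos_of_mem_stretch D h).2
  · rw [h3, Finset.mem_union] at h
    rcases h with h | h
    · exact Or.inl (posIdx_dpos_of_mem_stretch D h).2
    · exact Or.inr (posIdx_dpos_of_mem_stretch D h).2

/-- Auxiliary. [folklore] -/
private theorem arcColour_false_table (r : Fin 5) :
    arcColour r false (r + 1) = true ∧ arcColour r false (r + 2) = false ∧ arcColour r false (r + 3) = true ∧
      arcColour r false (r + 4) = false ∧ arcColour r false r = false := by
  revert r; decide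

/-- **the colour bridge**: the outer colour of a boundary dart in the tree's 4-marked colouring of `D.forget r`
(`A₀⁺, A₂⁺` black) is the D1-v2 colour `arcColour r false` of its `D`-stretch. [cite: BollobasRiordan2006, Ch. 7 Lemma 5 pp. 169–171] -/
theorem bdryCol_forget (r : Fin 5) {d : Site 2 × Site 2} (hd : d ∈ triBdryDarts D.verts) :
    (D.forget r).bdryCol ((D.forget r).dpos d) = arcColour r false (stretchIdx D d) := by
  obtain ⟨c1, c2, c3, c4, c0⟩ := arcColour_false_table r
  have hmem := mem_forget_stretch D r hd
  obtain ⟨g0, g1, g2, g3⟩ := posIdx_of_mem_forget_stretch D r hmem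
  unfold TriMarkedDomain.bdryCol
  rw [stretchIdx_eq_posIdx D hd]
  generalize hi : (D.forget r).stretchIdx ((D.forget r).dpos d) = i' at g0 g1 g2 g3
  fin_cases i'
  · rw [g0 rfl, c1]; rfl
  · rw [g1 rfl, c2]; rfl
  · rw [g2 rfl, c3]; rfl
  · rcases g3 rfl with h | h
    · rw [h, c4]; rfl
    · rw [h, c0]; rfl

/-- the tree's vertex colours on `D.forget r` (open set `σ`) are the D1-v2 colours `vcol5 … r false`, at every
vertex of a face touching `G`. [cite: BollobasRiordan2006, Ch. 7 Lemma 5 pp. 169–171] -/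
theorem vcol_forget (σ : SiteConfig (Site 2)) (r : Fin 5) {F : HexVertex} {w : Fin 3}
    (ht : faceVertex F w ∈ D.verts ∨ faceVertex F (w + 1) ∈ D.verts ∨ faceVertex F (w + 2) ∈ D.verts) :
    (D.forget r).vcol σ F w = vcol5 D σ r false F w := by
  classical
  have e4 : w + 2 + 1 = w := by rw [add_assoc]; exact add_eq_left.2 (by decide)
  unfold TriMarkedDomain.vcol vcol5
  simp only [TriMarkedDomain.forget_verts]
  by_cases h0 : faceVertex F w ∈ D.verts
  · rw [if_pos h0, if_pos h0]
  · rw [if_neg h0, if_neg h0]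
    by_cases h1 : faceVertex F (w + 1) ∈ D.verts
    · rw [if_pos h1, if_pos h1]
      exact bdryCol_forget D r (faceDart_mem₅' h1 h0)
    · rw [if_neg h1, if_neg h1]
      have h2 : faceVertex F (w + 2) ∈ D.verts := by
        rcases ht with h | h | h
        · exact absurd h h0
        · exact absurd h h1
        · exact h
      exact bdryCol_forget D r (by
        have := faceDart_mem₅ (j := w + 2) h2 (by rw [e4]; exact h0)
        rwa [e4] at this)

/-- **an exit step of the tree's walk on `D.forget r` is an `IStep` of `(σ, r, false)`.** [cite: BollobasRiordan2006, Ch. 7 Lemma 5 pp. 169–171] -/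
theorem iStep_of_isExit (σ : SiteConfig (Site 2)) (r : Fin 5) {F : HexVertex} {j : Fin 3}
    (hX : (D.forget r).IsExit σ F j) : IStep D σ r false F (oppFace F j) := by
  have e2 : j + 1 + 1 = j + 2 := by rw [add_assoc]; rfl
  have e3 : j + 1 + 2 = j := by rw [add_assoc]; exact add_eq_left.2 (by decide)
  have e4 : j + 2 + 1 = j := by rw [add_assoc]; exact add_eq_left.2 (by decide)
  have e5 : j + 2 + 2 = j + 1 := by rw [add_assoc]; congr 1
  obtain ⟨hG, ht, hf⟩ := (D.forget r).isExit_iff.1 hX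
  have hG' : HasG5 D F j := hG
  have ht1 : faceVertex F (j + 1) ∈ D.verts ∨ faceVertex F (j + 1 + 1) ∈ D.verts ∨ faceVertex F (j + 1 + 2) ∈ D.verts := by
    rw [e2]; rcases hG' with h | h
    · exact Or.inl h
    · exact Or.inr (Or.inl h)
  have ht2 : faceVertex F (j + 2) ∈ D.verts ∨ faceVertex F (j + 2 + 1) ∈ D.verts ∨ faceVertex F (j + 2 + 2) ∈ D.verts := by
    rw [e5]; rcases hG' with h | h
    · exact Or.inr (Or.inr h)
    · exact Or.inl h
  rw [vcol_forget D σ r ht1] at ht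
  rw [vcol_forget D σ r ht2] at hf
  refine (iStep_iff D σ r false F _).2 ⟨j, rfl, (bicol_side_iff D σ r false hG').2 ?_⟩
  rw [ht, hf]; decide

/-- **a type-II face whose two boundary darts have different `D`-indices is the corner face of the mark
between them** (the step used in (P)). [cite: BollobasRiordan2006, Ch. 7 Lemma 5 pp. 169–171] -/
theorem typeII_corner {F : HexVertex} {v : Fin 3} (hv : faceVertex F v ∈ D.verts)
    (hv1 : faceVertex F (v + 1) ∉ D.verts) (hv2 : faceVertex F (v + 2) ∉ D.verts)
    (hne : posIdx D (D.dpos (faceVertex F v, faceVertex F (v + 1))) ≠ posIdx D (D.dpos (faceVertex F v, faceVertex F (v + 2)))) :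
    ∃ m : Fin 5, posIdx D (D.dpos (faceVertex F v, faceVertex F (v + 2))) = m ∧
      posIdx D (D.dpos (faceVertex F v, faceVertex F (v + 1))) = m - 1 ∧ IsCornerFace D m F := by
  have hd₁ : (faceVertex F v, faceVertex F (v + 1)) ∈ triBdryDarts D.verts := faceDart_mem₅ hv hv1
  have hsucc : triBdrySucc D.verts (faceVertex F v, faceVertex F (v + 1)) = (faceVertex F v, faceVertex F (v + 2)) := by
    rw [succ_faceDart₅, if_neg hv2]
  obtain ⟨i, hi⟩ : ∃ i : Fin 5, (D.dpos (faceVertex F v, faceVertex F (v + 1)) + 1) % #(triBdryDarts D.verts) = D.pos i := by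
    by_contra hno
    push Not at hno
    apply hne
    rw [← hsucc, D.dpos_succ hd₁, posIdx_mod, posIdx_succ_eq D hno]
  have h2 : (faceVertex F v, faceVertex F (v + 2)) = D.markDart i := by
    have := iter_succ_eq_markDart D hi
    rwa [triBdryIter_succ, D.iter_dpos hd₁, hsucc] at this
  have h1 : (faceVertex F v, faceVertex F (v + 1)) = predDart D i := by
    have := iter_eq_predDart D hi
    rwa [D.iter_dpos hd₁] at this
  refine ⟨i, ?_, ?_, ?_⟩
  · rw [h2, ← stretchIdx_eq_posIdx D (markDart_mem D i), stretchIdx_markDart]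
  · rw [h1, ← stretchIdx_eq_posIdx D (predDart_mem D i), stretchIdx_predDart]
  · unfold IsCornerFace
    have em : D.markSite i = faceVertex F v := (congrArg Prod.fst h2).symm
    have eo : (D.markDart i).2 = faceVertex F (v + 2) := (congrArg Prod.snd h2).symm
    have eo' : (predDart D i).2 = faceVertex F (v + 1) := (congrArg Prod.snd h1).symm
    rw [hexFaceVertices_eq_triple F v, em, eo, eo', Finset.pair_comm]

/-- **the starting face of the tree's walk on `D.forget r` is the corner face `y_{r+1}`.** [cite: BollobasRiordan2006, Ch. 7 Lemma 5 pp. 169–171] -/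
theorem isCornerFace_startFace (r : Fin 5) : IsCornerFace D (r + 1) (D.forget r).startFace := by
  obtain ⟨v, -, hv, hv1, hv2, hp1, hp2⟩ := (D.forget r).startFace_spec
  have hd₁ : (faceVertex (D.forget r).startFace v, faceVertex (D.forget r).startFace (v + 1)) ∈ triBdryDarts D.verts :=
    faceDart_mem₅ hv hv1
  have hd₂ : (faceVertex (D.forget r).startFace v, faceVertex (D.forget r).startFace (v + 2)) ∈ triBdryDarts D.verts := by
    have e4 : v + 2 + 1 = v := by rw [add_assoc]; exact add_eq_left.2 (by decide)
    have := faceDart_mem₅' (j := v + 2) (by rw [e4]; exact hv) hv2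
    rwa [e4] at this
  have hs1 := mem_forget_stretch D r hd₁
  have hs2 := mem_forget_stretch D r hd₂
  rw [hp1, (D.forget r).stretchIdx_last] at hs1
  rw [hp2, (D.forget r).stretchIdx_zero] at hs2
  have g1 := (posIdx_of_mem_forget_stretch D r hs1).2.2.2 rfl
  have g2 := (posIdx_of_mem_forget_stretch D r hs2).1 rfl
  obtain ⟨m, hm, -, hcorner⟩ := typeII_corner D hv hv1 hv2 (by
    rw [g2]; rcases g1 with h | h
    · rw [h]; exact (by decide : ∀ r : Fin 5, r + 4 ≠ r + 1) r
    · rw [h]; exact (by decide : ∀ r : Fin 5, r ≠ r + 1) r)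
  rw [g2] at hm
  rw [hm]; exact hcorner

/-- **the terminal face of the tree's walk**: a face of `D.forget r` entered through a side and with no exit side
is type-II at a marked site `v_i`, its two boundary darts in the stretches `i - 1` (black) and `i` (white). [cite: BollobasRiordan2006, Ch. 7 Lemma 5 pp. 169–171] -/
theorem terminal_typeII (σ : SiteConfig (Site 2)) (r : Fin 5) {F : HexVertex} {j : Fin 3}
    (hE : (D.forget r).IsEntry σ F j) (hno : ∀ j', ¬ (D.forget r).IsExit σ F j') :
    ∃ (i : Fin 4) (v : Fin 3), faceVertex F v ∈ D.verts ∧ faceVertex F (v + 1) ∉ D.verts ∧ faceVertex F (v + 2) ∉ D.verts ∧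
      (D.forget r).stretchIdx ((D.forget r).dpos (faceVertex F v, faceVertex F (v + 1))) = i - 1 ∧
      (D.forget r).stretchIdx ((D.forget r).dpos (faceVertex F v, faceVertex F (v + 2))) = i ∧
      TriMarkedDomain.bcolOf (i - 1) = true ∧ TriMarkedDomain.bcolOf i = false ∧
      faceVertex F v = (D.forget r).markSite i ∧
      ((j = v + 1 ∧ (D.forget r).vcol σ F v = true) ∨ (j = v + 2 ∧ (D.forget r).vcol σ F v = false)) := by
  set D' := D.forget r with hD'
  obtain ⟨hG, hf, ht⟩ := D'.isEntry_iff.1 hE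
  have e2 : j + 1 + 1 = j + 2 := by rw [add_assoc]; rfl
  have e3 : j + 1 + 2 = j := by rw [add_assoc]; exact add_eq_left.2 (by decide)
  have e4 : j + 2 + 1 = j := by rw [add_assoc]; exact add_eq_left.2 (by decide)
  have e5 : j + 2 + 2 = j + 1 := by rw [add_assoc]; congr 1
  by_cases hc : D'.vcol σ F j = true
  · -- candidate exit `j + 2` is not an exit, so it has no `G` endpoint: type-II at `x_{j+2}`
    have hG' : ¬ D'.HasG F (j + 2) := fun hG' =>
      hno (j + 2) (D'.isExit_iff.2 ⟨hG', by rw [e4]; exact hc, by rw [e5]; exact hf⟩)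
    have hj0 : faceVertex F j ∉ D'.verts := fun h' => hG' (Or.inl (by rw [e4]; exact h'))
    have hj1 : faceVertex F (j + 1) ∉ D'.verts := fun h' => hG' (Or.inr (by rw [e5]; exact h'))
    have hu : faceVertex F (j + 2) ∈ D'.verts := by
      rcases hG with h' | h'
      · exact absurd h' hj1
      · exact h'
    have hcj : D'.vcol σ F j = D'.bdryCol (D'.dpos (faceVertex F (j + 2), faceVertex F j)) := by
      unfold TriMarkedDomain.vcol; rw [if_neg hj0, if_neg hj1]
    have hcj1 : D'.vcol σ F (j + 1) = D'.bdryCol (D'.dpos (faceVertex F (j + 2), faceVertex F (j + 1))) := by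
      unfold TriMarkedDomain.vcol; rw [if_neg hj1, e2, if_pos hu]
    obtain ⟨i, hmark, hs1, hs2⟩ := D'.transition (v := j + 2) hu (by rw [e4]; exact hj0) (by rw [e5]; exact hj1) (by
      rw [e4, e5, ← hcj, ← hcj1, hc, hf]; decide)
    refine ⟨i, j + 2, hu, by rw [e4]; exact hj0, by rw [e5]; exact hj1, hs1, hs2, ?_, ?_, hmark, Or.inl ⟨e4.symm, ht⟩⟩
    · have : D'.bdryCol (D'.dpos (faceVertex F (j + 2), faceVertex F (j + 2 + 1))) = true := by rw [e4, ← hcj, hc]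
      unfold TriMarkedDomain.bdryCol at this; rwa [hs1] at this
    · have : D'.bdryCol (D'.dpos (faceVertex F (j + 2), faceVertex F (j + 2 + 2))) = false := by rw [e5, ← hcj1, hf]
      unfold TriMarkedDomain.bdryCol at this; rwa [hs2] at this
  · have hc' : D'.vcol σ F j = false := by simpa using hc
    have hG' : ¬ D'.HasG F (j + 1) := fun hG' =>
      hno (j + 1) (D'.isExit_iff.2 ⟨hG', by rw [e2]; exact ht, by rw [e3]; exact hc'⟩)
    have hj2 : faceVertex F (j + 2) ∉ D'.verts := fun h' => hG' (Or.inl (by rw [e2]; exact h'))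
    have hj0 : faceVertex F j ∉ D'.verts := fun h' => hG' (Or.inr (by rw [e3]; exact h'))
    have hu : faceVertex F (j + 1) ∈ D'.verts := by
      rcases hG with h' | h'
      · exact h'
      · exact absurd h' hj2
    have hcj2 : D'.vcol σ F (j + 2) = D'.bdryCol (D'.dpos (faceVertex F (j + 1), faceVertex F (j + 2))) := by
      unfold TriMarkedDomain.vcol; rw [if_neg hj2, e4, if_neg hj0, e5]
    have hcj : D'.vcol σ F j = D'.bdryCol (D'.dpos (faceVertex F (j + 1), faceVertex F j)) := by
      unfold TriMarkedDomain.vcol; rw [if_neg hj0, if_pos hu]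
    obtain ⟨i, hmark, hs1, hs2⟩ := D'.transition (v := j + 1) hu (by rw [e2]; exact hj2) (by rw [e3]; exact hj0) (by
      rw [e2, e3, ← hcj2, ← hcj, ht, hc']; decide)
    refine ⟨i, j + 1, hu, by rw [e2]; exact hj2, by rw [e3]; exact hj0, hs1, hs2, ?_, ?_, hmark, Or.inr ⟨e3.symm, hf⟩⟩
    · have : D'.bdryCol (D'.dpos (faceVertex F (j + 1), faceVertex F (j + 1 + 1))) = true := by rw [e2, ← hcj2, ht]
      unfold TriMarkedDomain.bdryCol at this; rwa [hs1] at this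
    · have : D'.bdryCol (D'.dpos (faceVertex F (j + 1), faceVertex F (j + 1 + 2))) = false := by rw [e3, ← hcj, hc']
      unfold TriMarkedDomain.bdryCol at this; rwa [hs2] at this

/-- Auxiliary. [folklore] -/
private theorem bcolOf_cases {i : Fin 4} (h1 : TriMarkedDomain.bcolOf (i - 1) = true) (h2 : TriMarkedDomain.bcolOf i = false) :
    i = 1 ∨ i = 3 := by
  revert i; decide

/-- **LoopReach for `c = false`**: the tree's interface walk from `y_{r+1}` is an `IStep`-chain ending at `y_{r+2}`
(pattern A) or at `y_{r+4}` (pattern B). [cite: BollobasRiordan2006, Ch. 7 Lemma 5 pp. 169–171] -/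
theorem loopReach_false (σ : SiteConfig (Site 2)) (r : Fin 5) : MatchA D σ r false ∨ MatchB D σ r false := by
  classical
  set D' := D.forget r with hD'
  set f := D'.ifaceNext σ with hf
  set s₀ := D'.startFace with hs₀
  obtain ⟨n, hsteps, hend⟩ := exists_partialOrbit_end f (triFacesTouching D'.verts) s₀ D'.startFace_mem
    (fun x _ y hy => D'.ifaceNext_mem hy) (fun x _ x' _ y hy hy' => D'.ifaceNext_injective hy hy')
    (fun x _ hx => by
      obtain ⟨j, hj, he⟩ := D'.ifaceNext_eq_some hx
      have := D'.isEntry_oppFace hj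
      rw [← he] at this
      exact D'.not_isEntry_startFace _ this)
  -- the start has an exit, so `n ≥ 1`
  obtain ⟨v₀, j₀, -, -, -, -, -, -, hX₀, -⟩ := D'.exists_isExit_startFace (B := σ)
  have hn : n ≠ 0 := by
    rintro rfl
    exact D'.ifaceNext_ne_none hX₀ hend
  -- every later face is entered
  have key : ∀ t, 1 ≤ t → t ≤ n → ∃ j, D'.IsEntry σ (partialOrbit f s₀ t) j := by
    intro t ht htn
    obtain ⟨t', rfl⟩ : ∃ t', t = t' + 1 := ⟨t - 1, by omega⟩
    obtain ⟨j', hX, he⟩ := D'.ifaceNext_eq_some (hsteps t' (by omega))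
    exact ⟨oppIdx (partialOrbit f s₀ t') j', by rw [he]; exact D'.isEntry_oppFace hX⟩
  -- the walk is an `IStep`-chain
  have chain : ∀ t, t ≤ n → Relation.ReflTransGen (IStep D σ r false) s₀ (partialOrbit f s₀ t) := by
    intro t ht
    induction t with
    | zero => exact Relation.ReflTransGen.refl
    | succ t ih =>
      refine (ih (by omega)).tail ?_
      obtain ⟨j', hX, he⟩ := D'.ifaceNext_eq_some (hsteps t (by omega))
      rw [he]
      exact iStep_of_isExit D σ r hX
  -- the last face is terminal
  obtain ⟨j, hE⟩ := key n (Nat.pos_of_ne_zero hn) le_rfl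
  obtain ⟨i, v, hv, hv1, hv2, hs1, hs2, hb1, hb2, -, -⟩ :=
    terminal_typeII D σ r hE (fun j' => D'.ifaceNext_eq_none hend j')
  set F := partialOrbit f s₀ n with hF
  have hd₁ : (faceVertex F v, faceVertex F (v + 1)) ∈ triBdryDarts D.verts := faceDart_mem₅ hv hv1
  have hd₂ : (faceVertex F v, faceVertex F (v + 2)) ∈ triBdryDarts D.verts := by
    have e4 : v + 2 + 1 = v := by rw [add_assoc]; exact add_eq_left.2 (by decide)
    have := faceDart_mem₅' (j := v + 2) (by rw [e4]; exact hv) hv2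
    rwa [e4] at this
  have hm1 := mem_forget_stretch D r hd₁
  have hm2 := mem_forget_stretch D r hd₂
  rw [hs1] at hm1
  rw [hs2] at hm2
  have hstart : IsCornerFace D (r + 1) s₀ := isCornerFace_startFace D r
  rcases bcolOf_cases hb1 hb2 with rfl | rfl
  · -- `i = 1`: darts in `A_{r+1}`, `A_{r+2}` ⇒ the terminal face is `y_{r+2}`: pattern A
    have g1 := (posIdx_of_mem_forget_stretch D r hm1).1 (by decide)
    have g2 := (posIdx_of_mem_forget_stretch D r hm2).2.1 rfl
    obtain ⟨m, hm, -, hcorner⟩ := typeII_corner D hv hv1 hv2 (by rw [g1, g2]; exact (by decide : ∀ r : Fin 5, r + 1 ≠ r + 2) r)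
    rw [g2] at hm
    left
    exact ⟨s₀, F, hstart, hm ▸ hcorner, chain n le_rfl⟩
  · -- `i = 3`: darts in `A_{r+3}`, `A_{r+4} ∪ A_r` ⇒ the terminal face is `y_{r+4}`: pattern B
    have g1 := (posIdx_of_mem_forget_stretch D r hm1).2.2.1 (by decide)
    have g2 := (posIdx_of_mem_forget_stretch D r hm2).2.2.2 rfl
    obtain ⟨m, hm, hm', hcorner⟩ := typeII_corner D hv hv1 hv2 (by
      rw [g1]; rcases g2 with h | h
      · rw [h]; exact (by decide : ∀ r : Fin 5, r + 3 ≠ r + 4) r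
      · rw [h]; exact (by decide : ∀ r : Fin 5, r + 3 ≠ r) r)
    have hm4 : m = r + 4 := by
      rcases g2 with h | h
      · exact (hm.symm.trans h)
      · -- `m = r` would give `posIdx d₁ = r - 1 = r + 4 ≠ r + 3`
        exfalso
        rw [g1] at hm'
        rw [← hm, h] at hm'
        exact absurd hm' ((by decide : ∀ r : Fin 5, r + 3 ≠ r - 1) r)
    right
    exact ⟨s₀, F, hstart, hm4 ▸ hcorner, chain n le_rfl⟩

/-! ### The tree's side invariants, refined: the black half escapes only to an OPEN crossing `A₀ ↔ A₂`, the white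
half only to a CLOSED crossing `A₁ ↔ A₃` (the tree merges both escapes into `Done`; its proofs of `exitInv_succ` /
`exitInv_succ_succ` are repeated verbatim with the escapes kept apart). For any 4-marked domain `D4` and open set `B`. -/

section Walk4

variable (D4 : TriMarkedDomain 4)

/-- refined exit invariant. [cite: BollobasRiordan2006, Ch. 7 Lemma 5 pp. 169–171] -/
def ExitInv' (B : Set (Site 2)) (F : HexVertex) (j : Fin 3) : Prop :=
  (D4.PB B (faceVertex F (j + 2)) (faceVertex F (j + 1)) ∨ D4.IsOpenCrossing B 0 2) ∧
    (D4.PW B (faceVertex F (j + 1)) (faceVertex F (j + 2)) ∨ D4.IsClosedCrossing B 1 3)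

/-- refined entry invariant. [cite: BollobasRiordan2006, Ch. 7 Lemma 5 pp. 169–171] -/
def EntryInv' (B : Set (Site 2)) (F : HexVertex) (j : Fin 3) : Prop :=
  (D4.PB B (faceVertex F (j + 1)) (faceVertex F (j + 2)) ∨ D4.IsOpenCrossing B 0 2) ∧
    (D4.PW B (faceVertex F (j + 2)) (faceVertex F (j + 1)) ∨ D4.IsClosedCrossing B 1 3)

variable {B : Set (Site 2)}

/-- the refined invariant crosses the bond. [cite: BollobasRiordan2006, Ch. 7 Lemma 5 pp. 169–171] -/
theorem entryInv'_oppFace {F : HexVertex} {j : Fin 3} (h : ExitInv' D4 B F j) :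
    EntryInv' D4 B (oppFace F j) (oppIdx F j) := by
  unfold EntryInv'
  rw [faceVertex_oppFace_succ, faceVertex_oppFace_succ_succ]
  exact h

/-- refined step, exit side `j + 1` (port of the tree's `exitInv_succ`). [cite: BollobasRiordan2006, Ch. 7 Lemma 5 pp. 169–171] -/
theorem exitInv'_succ {F : HexVertex} {j : Fin 3} (hE : D4.IsEntry B F j) (hI : EntryInv' D4 B F j)
    (hX : D4.IsExit B F (j + 1)) : ExitInv' D4 B F (j + 1) := by
  have hE' := (D4.isEntry_iff).1 hE
  have hX' := (D4.isExit_iff).1 hX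
  obtain ⟨hG, hf1, ht2⟩ := hE'
  obtain ⟨hG', _, hf0⟩ := hX'
  rw [TriMarkedDomain.fin3_add_one_add_two] at hf0
  obtain ⟨hB, hW⟩ := hI
  unfold ExitInv'
  rw [TriMarkedDomain.fin3_add_one_add_one, TriMarkedDomain.fin3_add_one_add_two]
  unfold TriMarkedDomain.HasG at hG hG'
  rw [TriMarkedDomain.fin3_add_one_add_one, TriMarkedDomain.fin3_add_one_add_two] at hG'
  set x₀ := faceVertex F j with hx₀
  set x₁ := faceVertex F (j + 1) with hx₁
  set x₂ := faceVertex F (j + 2) with hx₂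
  constructor
  · rcases hB with hB | hD
    · left
      by_cases h2 : x₂ ∈ D4.verts
      · rwa [D4.pb_of_mem h2] at hB ⊢
      · have h1 : x₁ ∈ D4.verts := hG.resolve_right h2
        have h0 : x₀ ∈ D4.verts := hG'.resolve_left h2
        rw [D4.pb_of_not_mem h2] at hB ⊢
        have := D4.stretchIdx_views_eq (F := F) (j := j + 2) h2
          (by rw [TriMarkedDomain.fin3_add_two_add_one]; exact h0) (by rw [TriMarkedDomain.fin3_add_two_add_two]; exact h1)
        rw [TriMarkedDomain.fin3_add_two_add_one, TriMarkedDomain.fin3_add_two_add_two] at this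
        rw [← this]; exact hB
    · exact Or.inr hD
  · rcases hW with hW | hD
    · by_cases h1 : x₁ ∈ D4.verts
      · rw [D4.pw_of_mem h1] at hW
        obtain ⟨a, ha, hp⟩ := hW
        by_cases h0 : x₀ ∈ D4.verts
        · left
          rw [D4.pw_of_mem h0]
          have hx0B : x₀ ∉ B := (D4.vcol_eq_false_iff_of_mem h0).1 hf0
          exact ⟨a, ha, hp.tail (TriMarkedDomain.adj_faceVertex_succ F j).symm ⟨mem_coe.2 h0, hx0B⟩⟩
        · have h2 : x₂ ∈ D4.verts := hG'.resolve_right h0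
          have hs : D4.stretchIdx (D4.dpos (x₂, x₀)) = D4.stretchIdx (D4.dpos (x₁, x₀)) :=
            D4.stretchIdx_views_eq (F := F) (j := j) h0 h1 h2
          have hc : D4.bdryCol (D4.dpos (x₁, x₀)) = false := by
            rw [← D4.vcol_of_not_mem_of_mem h0 h1]; exact hf0
          unfold TriMarkedDomain.bdryCol at hc
          rcases (TriMarkedDomain.bcolOf_eq_false_iff _).1 hc with hs1 | hs3
          · -- stretch `1`: `x₁ ∈ A₁` is joined to `A₃` by a closed path — the CLOSED escape
            right
            have hx1 : x₁ ∈ D4.arc 1 := by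
              have := D4.fst_mem_arc_of_mem (D4.faceDart_mem' (j := j) h1 h0)
              rwa [hs1] at this
            exact ⟨x₁, hx1, a, ha, hp.symm⟩
          · left
            rw [D4.pw_of_not_mem h0, hs, hs3]
      · have h2 : x₂ ∈ D4.verts := hG.resolve_left h1
        rw [D4.pw_of_not_mem h1] at hW
        by_cases h0 : x₀ ∈ D4.verts
        · left
          rw [D4.pw_of_mem h0]
          have hx0B : x₀ ∉ B := (D4.vcol_eq_false_iff_of_mem h0).1 hf0
          have hd : (x₀, x₁) ∈ triBdryDarts D4.verts := D4.faceDart_mem (j := j) h0 h1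
          have hsucc : triBdrySucc D4.verts (x₀, x₁) = (x₂, x₁) := by
            rw [hx₀, hx₁, D4.succ_faceDart, if_pos h2]
          have hs := D4.bdryCol_dpos_succ_of_fst_ne hd (by
            rw [hsucc]; exact TriMarkedDomain.faceVertex_add_ne F j (k := 2) (by decide))
          rw [hsucc, hW] at hs
          have hx0 : x₀ ∈ D4.arc 3 := by
            have := D4.fst_mem_arc_of_mem hd
            rwa [← hs] at this
          exact ⟨x₀, hx0, PathIn.refl ⟨mem_coe.2 h0, hx0B⟩⟩
        · left
          rw [D4.pw_of_not_mem h0]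
          have hd : (x₂, x₀) ∈ triBdryDarts D4.verts := by
            have := D4.faceDart_mem (j := j + 2) h2 (by rw [TriMarkedDomain.fin3_add_two_add_one]; exact h0)
            rwa [TriMarkedDomain.fin3_add_two_add_one] at this
          have hsucc : triBdrySucc D4.verts (x₂, x₀) = (x₂, x₁) := by
            have := D4.succ_faceDart (F := F) (j := j + 2)
            rw [TriMarkedDomain.fin3_add_two_add_one, TriMarkedDomain.fin3_add_two_add_two] at this
            rw [this, if_neg h1]
          have hc0 : D4.bdryCol (D4.dpos (x₂, x₀)) = false := by
            rw [← D4.vcol_of_not_mem_of_not_mem h0 h1]; exact hf0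
          have hc1 : D4.bdryCol (D4.dpos (x₂, x₁)) = false := by
            have := D4.vcol_of_not_mem_of_mem (B := B) h1 (by rw [TriMarkedDomain.fin3_add_one_add_one]; exact h2)
            rw [TriMarkedDomain.fin3_add_one_add_one] at this
            rw [← this]; exact hf1
          have := D4.stretchIdx_dpos_succ_of_bdryCol_eq hd (by rw [hsucc, hc0, hc1])
          rw [hsucc, hW] at this
          exact this.symm
    · exact Or.inr hD

/-- refined step, exit side `j + 2` (port of the tree's `exitInv_succ_succ`). [cite: BollobasRiordan2006, Ch. 7 Lemma 5 pp. 169–171] -/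
theorem exitInv'_succ_succ {F : HexVertex} {j : Fin 3} (hE : D4.IsEntry B F j) (hI : EntryInv' D4 B F j)
    (hX : D4.IsExit B F (j + 2)) : ExitInv' D4 B F (j + 2) := by
  have hE' := (D4.isEntry_iff).1 hE
  have hX' := (D4.isExit_iff).1 hX
  obtain ⟨hG, hf1, ht2⟩ := hE'
  obtain ⟨hG', ht0, _⟩ := hX'
  rw [TriMarkedDomain.fin3_add_two_add_one] at ht0
  obtain ⟨hB, hW⟩ := hI
  unfold ExitInv'
  rw [TriMarkedDomain.fin3_add_two_add_one, TriMarkedDomain.fin3_add_two_add_two]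
  unfold TriMarkedDomain.HasG at hG hG'
  rw [TriMarkedDomain.fin3_add_two_add_one, TriMarkedDomain.fin3_add_two_add_two] at hG'
  set x₀ := faceVertex F j with hx₀
  set x₁ := faceVertex F (j + 1) with hx₁
  set x₂ := faceVertex F (j + 2) with hx₂
  constructor
  · rcases hB with hB | hD
    · by_cases h2 : x₂ ∈ D4.verts
      · rw [D4.pb_of_mem h2] at hB
        obtain ⟨a, ha, hp⟩ := hB
        by_cases h0 : x₀ ∈ D4.verts
        · left
          rw [D4.pb_of_mem h0]
          have hx0B : x₀ ∈ B := (D4.vcol_eq_true_iff_of_mem h0).1 ht0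
          have hadj : triGraph.Adj x₂ x₀ := by
            have := TriMarkedDomain.adj_faceVertex_succ F (j + 2)
            rwa [TriMarkedDomain.fin3_add_two_add_one] at this
          exact ⟨a, ha, hp.tail hadj ⟨mem_coe.2 h0, hx0B⟩⟩
        · have h1 : x₁ ∈ D4.verts := hG'.resolve_left h0
          have hs : D4.stretchIdx (D4.dpos (x₂, x₀)) = D4.stretchIdx (D4.dpos (x₁, x₀)) :=
            D4.stretchIdx_views_eq (F := F) (j := j) h0 h1 h2
          have hc : D4.bdryCol (D4.dpos (x₁, x₀)) = true := by
            rw [← D4.vcol_of_not_mem_of_mem h0 h1]; exact ht0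
          unfold TriMarkedDomain.bdryCol at hc
          rcases (TriMarkedDomain.bcolOf_eq_true_iff _).1 hc with hs0 | hs2
          · left
            rw [D4.pb_of_not_mem h0, hs0]
          · -- stretch `2`: `x₂ ∈ A₂` is joined to `A₀` by an open path — the OPEN escape
            right
            have hx2 : x₂ ∈ D4.arc 2 := by
              have hd : (x₂, x₀) ∈ triBdryDarts D4.verts := by
                have := D4.faceDart_mem (j := j + 2) h2 (by rw [TriMarkedDomain.fin3_add_two_add_one]; exact h0)
                rwa [TriMarkedDomain.fin3_add_two_add_one] at this
              have := D4.fst_mem_arc_of_mem hd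
              rwa [hs, hs2] at this
            exact ⟨a, ha, x₂, hx2, hp⟩
      · have h1 : x₁ ∈ D4.verts := hG.resolve_right h2
        rw [D4.pb_of_not_mem h2] at hB
        by_cases h0 : x₀ ∈ D4.verts
        · left
          rw [D4.pb_of_mem h0]
          have hx0B : x₀ ∈ B := (D4.vcol_eq_true_iff_of_mem h0).1 ht0
          have hd : (x₁, x₂) ∈ triBdryDarts D4.verts := by
            have := D4.faceDart_mem (j := j + 1) h1 (by rw [TriMarkedDomain.fin3_add_one_add_one]; exact h2)
            rwa [TriMarkedDomain.fin3_add_one_add_one] at this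
          have hsucc : triBdrySucc D4.verts (x₁, x₂) = (x₀, x₂) := by
            have := D4.succ_faceDart (F := F) (j := j + 1)
            rw [TriMarkedDomain.fin3_add_one_add_one, TriMarkedDomain.fin3_add_one_add_two] at this
            rw [this, if_pos h0]
          have hs := D4.bdryCol_dpos_succ_of_fst_ne hd (by
            rw [hsucc]
            exact (TriMarkedDomain.faceVertex_add_ne F j (k := 1) (by decide)).symm)
          rw [hsucc, hB] at hs
          have hd0 : (x₀, x₂) ∈ triBdryDarts D4.verts := by
            rw [← hsucc]; exact triBdrySucc_mem hd
          have hx0 : x₀ ∈ D4.arc 0 := by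
            have := D4.fst_mem_arc_of_mem hd0
            rwa [hs] at this
          exact ⟨x₀, hx0, PathIn.refl ⟨mem_coe.2 h0, hx0B⟩⟩
        · left
          rw [D4.pb_of_not_mem h0]
          have hd : (x₁, x₂) ∈ triBdryDarts D4.verts := by
            have := D4.faceDart_mem (j := j + 1) h1 (by rw [TriMarkedDomain.fin3_add_one_add_one]; exact h2)
            rwa [TriMarkedDomain.fin3_add_one_add_one] at this
          have hsucc : triBdrySucc D4.verts (x₁, x₂) = (x₁, x₀) := by
            have := D4.succ_faceDart (F := F) (j := j + 1)
            rw [TriMarkedDomain.fin3_add_one_add_one, TriMarkedDomain.fin3_add_one_add_two] at this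
            rw [this, if_neg h0]
          have hc2 : D4.bdryCol (D4.dpos (x₁, x₂)) = true := by
            have := D4.vcol_of_not_mem_of_not_mem (B := B) (F := F) (j := j + 2) h2
              (by rw [TriMarkedDomain.fin3_add_two_add_one]; exact h0)
            rw [TriMarkedDomain.fin3_add_two_add_two] at this
            rw [← this]; exact ht2
          have hc0 : D4.bdryCol (D4.dpos (x₁, x₀)) = true := by
            rw [← D4.vcol_of_not_mem_of_mem h0 h1]; exact ht0
          have := D4.stretchIdx_dpos_succ_of_bdryCol_eq hd (by rw [hsucc, hc0, hc2])
          rw [hsucc, hB] at this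
          exact this
    · exact Or.inr hD
  · rcases hW with hW | hD
    · left
      by_cases h1 : x₁ ∈ D4.verts
      · rwa [D4.pw_of_mem h1] at hW ⊢
      · have h2 : x₂ ∈ D4.verts := hG.resolve_left h1
        have h0 : x₀ ∈ D4.verts := hG'.resolve_right h1
        rw [D4.pw_of_not_mem h1] at hW ⊢
        have := D4.stretchIdx_views_eq (F := F) (j := j + 1) h1
          (by rw [TriMarkedDomain.fin3_add_one_add_one]; exact h2) (by rw [TriMarkedDomain.fin3_add_one_add_two]; exact h0)
        rw [TriMarkedDomain.fin3_add_one_add_one, TriMarkedDomain.fin3_add_one_add_two] at this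
        rw [this]; exact hW
    · exact Or.inr hD

/-- refined step (port of `exitInv_of_entryInv`). [cite: BollobasRiordan2006, Ch. 7 Lemma 5 pp. 169–171] -/
theorem exitInv'_of_entryInv' {F : HexVertex} {j j' : Fin 3} (hE : D4.IsEntry B F j)
    (hI : EntryInv' D4 B F j) (hX : D4.IsExit B F j') : ExitInv' D4 B F j' := by
  have hne : j' ≠ j := fun e => D4.not_isExit_of_isEntry hE (e ▸ hX)
  have hc : j' = j + 1 ∨ j' = j + 2 := by
    revert hne; fin_cases j <;> fin_cases j' <;> decide
  rcases hc with rfl | rfl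
  · exact exitInv'_succ D4 hE hI hX
  · exact exitInv'_succ_succ D4 hE hI hX

/-- the refined invariant at the exit of the starting face (port of `exitInv_startFace`, same exit side). [cite: BollobasRiordan2006, Ch. 7 Lemma 5 pp. 169–171] -/
theorem exitInv'_startFace : ∃ j, D4.IsExit B D4.startFace j ∧ ExitInv' D4 B D4.startFace j := by
  obtain ⟨v, j, hm, hv, hv1, hv2, hp1, hp2, hX, hcase⟩ := D4.exists_isExit_startFace (B := B)
  refine ⟨j, hX, ?_⟩
  unfold ExitInv'
  rcases hcase with ⟨rfl, hb⟩ | ⟨rfl, hb⟩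
  · rw [TriMarkedDomain.fin3_add_two_add_one, TriMarkedDomain.fin3_add_two_add_two]
    constructor
    · left
      rw [D4.pb_of_mem hv]
      exact ⟨_, hm ▸ D4.markSite_mem_arc 0, PathIn.refl ⟨mem_coe.2 hv, hb⟩⟩
    · left
      rw [D4.pw_of_not_mem hv1, hp1, D4.stretchIdx_last]
  · rw [TriMarkedDomain.fin3_add_one_add_one, TriMarkedDomain.fin3_add_one_add_two]
    constructor
    · left
      rw [D4.pb_of_not_mem hv2, hp2, D4.stretchIdx_zero]
    · left
      rw [D4.pw_of_mem hv]
      exact ⟨_, hm ▸ D4.markSite_mem_arc_sub_one 0, PathIn.refl ⟨mem_coe.2 hv, hb⟩⟩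

/-- **at a terminal face the refined invariant names the crossing**: at the mark `1` a CLOSED crossing `A₁ ↔ A₃`,
at the mark `3` an OPEN crossing `A₀ ↔ A₂`. [cite: BollobasRiordan2006, Ch. 7 Lemma 5 pp. 169–171] -/
theorem crossing_of_terminal {F : HexVertex} {j v : Fin 3} {i : Fin 4} (hI : EntryInv' D4 B F j)
    (hmark : faceVertex F v = D4.markSite i) (hv : faceVertex F v ∈ D4.verts)
    (hv1 : faceVertex F (v + 1) ∉ D4.verts) (hv2 : faceVertex F (v + 2) ∉ D4.verts)
    (hs1 : D4.stretchIdx (D4.dpos (faceVertex F v, faceVertex F (v + 1))) = i - 1)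
    (hs2 : D4.stretchIdx (D4.dpos (faceVertex F v, faceVertex F (v + 2))) = i)
    (hbr : (j = v + 1 ∧ D4.vcol B F v = true) ∨ (j = v + 2 ∧ D4.vcol B F v = false)) :
    (i = 1 → D4.IsClosedCrossing B 1 3) ∧ (i = 3 → D4.IsOpenCrossing B 0 2) := by
  obtain ⟨hB, hW⟩ := hI
  rcases hbr with ⟨rfl, hcv⟩ | ⟨rfl, hcv⟩
  · rw [TriMarkedDomain.fin3_add_one_add_one, TriMarkedDomain.fin3_add_one_add_two] at hB hW
    constructor
    · rintro rfl
      rcases hW with hW | hD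
      · rw [D4.pw_of_not_mem hv2, hs2] at hW
        exact absurd hW (by decide)
      · exact hD
    · rintro rfl
      rcases hB with hB | hD
      · rw [D4.pb_of_mem hv] at hB
        obtain ⟨a, ha, hp⟩ := hB
        exact ⟨a, ha, faceVertex F v, hmark ▸ (by simpa using D4.markSite_mem_arc_sub_one 3), hp⟩
      · exact hD
  · rw [TriMarkedDomain.fin3_add_two_add_one, TriMarkedDomain.fin3_add_two_add_two] at hB hW
    constructor
    · rintro rfl
      rcases hW with hW | hD
      · rw [D4.pw_of_mem hv] at hW
        obtain ⟨a, ha, hp⟩ := hW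
        exact ⟨faceVertex F v, hmark ▸ D4.markSite_mem_arc 1, a, ha, hp.symm⟩
      · exact hD
    · rintro rfl
      rcases hB with hB | hD
      · rw [D4.pb_of_not_mem hv1, hs1] at hB
        exact absurd hB (by decide)
      · exact hD

end Walk4

/-- **LoopReach holds for every domain** (both colours, by the flip). [cite: BollobasRiordan2006, Ch. 7 Lemma 5 pp. 169–171] -/
theorem loopReach_holds : LoopReach D := by
  intro σ r c
  cases c
  · exact loopReach_false D σ r
  · have h := loopReach_false D σᶜ r
    have hf := loopFlip_holds D σᶜ r false
    rw [compl_compl] at hf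
    simp only [Bool.not_false] at hf
    rcases h with h | h
    · exact Or.inl (hf.1.2 h)
    · exact Or.inr (hf.2.2 h)

/-! ### MatchBOpen / MatchAClosed: the walk's endpoint names the crossing; `LoopUnique` kills the cross case -/

/-- **the walk dichotomy with crossings**: the tree's interface walk from `y_{r+1}` either ends at `y_{r+2}` having a
closed crossing `A_{r+2} ↔ A_{r+4} ∪ A_r` on its white side, or ends at `y_{r+4}` having an open crossing
`A_{r+1} ↔ A_{r+3}` on its black side (Bollobás–Riordan's Lemma 5 with the endpoint remembered). [cite: BollobasRiordan2006, Ch. 7 Lemma 5 pp. 169–171] -/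
theorem walk_dichotomy (σ : SiteConfig (Site 2)) (r : Fin 5) :
    (MatchA D σ r false ∧ (D.forget r).IsClosedCrossing σ 1 3) ∨
      (MatchB D σ r false ∧ (D.forget r).IsOpenCrossing σ 0 2) := by
  classical
  set D' := D.forget r with hD'
  set f := D'.ifaceNext σ with hf
  set s₀ := D'.startFace with hs₀
  obtain ⟨n, hsteps, hend⟩ := exists_partialOrbit_end f (triFacesTouching D'.verts) s₀ D'.startFace_mem
    (fun x _ y hy => D'.ifaceNext_mem hy) (fun x _ x' _ y hy hy' => D'.ifaceNext_injective hy hy')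
    (fun x _ hx => by
      obtain ⟨j, hj, he⟩ := D'.ifaceNext_eq_some hx
      have := D'.isEntry_oppFace hj
      rw [← he] at this
      exact D'.not_isEntry_startFace _ this)
  obtain ⟨j₀, hX₀, hI₀⟩ := exitInv'_startFace D' (B := σ)
  have hn : n ≠ 0 := by
    rintro rfl
    exact D'.ifaceNext_ne_none hX₀ hend
  -- entry + refined invariant along the walk
  have key : ∀ t, 1 ≤ t → t ≤ n → ∃ j, D'.IsEntry σ (partialOrbit f s₀ t) j ∧ EntryInv' D' σ (partialOrbit f s₀ t) j := by
    intro t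
    induction t with
    | zero => intro h; exact absurd h (by norm_num)
    | succ t ih =>
      intro _ htn
      have hstep := hsteps t (by omega)
      obtain ⟨j', hX, he⟩ := D'.ifaceNext_eq_some hstep
      rcases Nat.eq_zero_or_pos t with rfl | htpos
      · have hj' : j' = j₀ := D'.isExit_unique hX hX₀
        subst hj'
        refine ⟨oppIdx s₀ j', ?_, ?_⟩
        · rw [he]; exact D'.isEntry_oppFace hX
        · rw [he]; exact entryInv'_oppFace D' hI₀
      · obtain ⟨j, hE, hI⟩ := ih htpos (by omega)
        have hXI := exitInv'_of_entryInv' D' hE hI hX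
        refine ⟨oppIdx (partialOrbit f s₀ t) j', ?_, ?_⟩
        · rw [he]; exact D'.isEntry_oppFace hX
        · rw [he]; exact entryInv'_oppFace D' hXI
  have chain : ∀ t, t ≤ n → Relation.ReflTransGen (IStep D σ r false) s₀ (partialOrbit f s₀ t) := by
    intro t ht
    induction t with
    | zero => exact Relation.ReflTransGen.refl
    | succ t ih =>
      refine (ih (by omega)).tail ?_
      obtain ⟨j', hX, he⟩ := D'.ifaceNext_eq_some (hsteps t (by omega))
      rw [he]
      exact iStep_of_isExit D σ r hX
  obtain ⟨j, hE, hI⟩ := key n (Nat.pos_of_ne_zero hn) le_rfl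
  obtain ⟨i, v, hv, hv1, hv2, hs1, hs2, hb1, hb2, hmark, hbr⟩ :=
    terminal_typeII D σ r hE (fun j' => D'.ifaceNext_eq_none hend j')
  have hcross := crossing_of_terminal D' hI hmark hv hv1 hv2 hs1 hs2 hbr
  set F := partialOrbit f s₀ n with hF
  have hd₁ : (faceVertex F v, faceVertex F (v + 1)) ∈ triBdryDarts D.verts := faceDart_mem₅ hv hv1
  have hd₂ : (faceVertex F v, faceVertex F (v + 2)) ∈ triBdryDarts D.verts := by
    have e4 : v + 2 + 1 = v := by rw [add_assoc]; exact add_eq_left.2 (by decide)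
    have := faceDart_mem₅' (j := v + 2) (by rw [e4]; exact hv) hv2
    rwa [e4] at this
  have hm1 := mem_forget_stretch D r hd₁
  have hm2 := mem_forget_stretch D r hd₂
  rw [hs1] at hm1
  rw [hs2] at hm2
  have hstart : IsCornerFace D (r + 1) s₀ := isCornerFace_startFace D r
  rcases bcolOf_cases hb1 hb2 with rfl | rfl
  · have g1 := (posIdx_of_mem_forget_stretch D r hm1).1 (by decide)
    have g2 := (posIdx_of_mem_forget_stretch D r hm2).2.1 rfl
    obtain ⟨m, hm, -, hcorner⟩ := typeII_corner D hv hv1 hv2 (by rw [g1, g2]; exact (by decide : ∀ r : Fin 5, r + 1 ≠ r + 2) r)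
    rw [g2] at hm
    left
    exact ⟨⟨s₀, F, hstart, hm ▸ hcorner, chain n le_rfl⟩, hcross.1 rfl⟩
  · have g1 := (posIdx_of_mem_forget_stretch D r hm1).2.2.1 (by decide)
    have g2 := (posIdx_of_mem_forget_stretch D r hm2).2.2.2 rfl
    obtain ⟨m, hm, hm', hcorner⟩ := typeII_corner D hv hv1 hv2 (by
      rw [g1]; rcases g2 with h | h
      · rw [h]; exact (by decide : ∀ r : Fin 5, r + 3 ≠ r + 4) r
      · rw [h]; exact (by decide : ∀ r : Fin 5, r + 3 ≠ r) r)
    have hm4 : m = r + 4 := by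
      rcases g2 with h | h
      · exact (hm.symm.trans h)
      · exfalso
        rw [g1] at hm'
        rw [← hm, h] at hm'
        exact absurd hm' ((by decide : ∀ r : Fin 5, r + 3 ≠ r - 1) r)
    right
    exact ⟨⟨s₀, F, hstart, hm4 ▸ hcorner, chain n le_rfl⟩, hcross.2 rfl⟩

/-- the arcs of `D.forget r` (tree, by cases on `r`). [cite: BollobasRiordan2006, Ch. 7 Lemma 5 pp. 169–171] -/
theorem forget_arcs (r : Fin 5) :
    (D.forget r).arc 0 = D.arc (r + 1) ∧ (D.forget r).arc 1 = D.arc (r + 2) ∧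
      (D.forget r).arc 2 = D.arc (r + 3) ∧ (D.forget r).arc 3 = D.arc (r + 4) ∪ D.arc r := by
  fin_cases r
  · exact ⟨D.forget_zero_arc_zero, D.forget_zero_arc_one, D.forget_zero_arc_two, D.forget_zero_arc_three⟩
  · exact ⟨D.forget_one_arc_zero, D.forget_one_arc_one, D.forget_one_arc_two, D.forget_one_arc_three⟩
  · exact ⟨D.forget_two_arc_zero, D.forget_two_arc_one, D.forget_two_arc_two, D.forget_two_arc_three⟩
  · exact ⟨D.forget_three_arc_zero, D.forget_three_arc_one, D.forget_three_arc_two, D.forget_three_arc_three⟩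
  · exact ⟨D.forget_four_arc_zero, D.forget_four_arc_one, D.forget_four_arc_two, D.forget_four_arc_three⟩

/-- open crossings `A₀ ↔ A₂` of `D.forget r` are open crossings `A_{r+1} ↔ A_{r+3}` of `D`. [cite: BollobasRiordan2006, Ch. 7 Lemma 5 pp. 169–171] -/
theorem isOpenCrossing_forget (σ : SiteConfig (Site 2)) (r : Fin 5) :
    (D.forget r).IsOpenCrossing σ 0 2 ↔ D.IsOpenCrossing σ (r + 1) (r + 3) := by
  obtain ⟨h0, -, h2, -⟩ := forget_arcs D r
  simp only [TriMarkedDomain.IsOpenCrossing, h0, h2, TriMarkedDomain.forget_verts]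

/-- closed crossings `A₁ ↔ A₃` of `D.forget r` are closed crossings `A_{r+2} ↔ A_{r+4} ∪ A_r` of `D`. [cite: BollobasRiordan2006, Ch. 7 Lemma 5 pp. 169–171] -/
theorem isClosedCrossing_forget (σ : SiteConfig (Site 2)) (r : Fin 5) :
    (D.forget r).IsClosedCrossing σ 1 3 ↔ D.IsClosedCrossing σ (r + 2) (r + 4) ∨ D.IsClosedCrossing σ (r + 2) r := by
  obtain ⟨-, h1, -, h3⟩ := forget_arcs D r
  simp only [TriMarkedDomain.IsClosedCrossing, h1, h3, TriMarkedDomain.forget_verts, Finset.mem_union]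
  constructor
  · rintro ⟨u, hu, v, hv, hp⟩
    rcases hv with hv | hv
    · exact Or.inl ⟨u, hu, v, hv, hp⟩
    · exact Or.inr ⟨u, hu, v, hv, hp⟩
  · rintro (⟨u, hu, v, hv, hp⟩ | ⟨u, hu, v, hv, hp⟩)
    · exact ⟨u, hu, v, Or.inl hv, hp⟩
    · exact ⟨u, hu, v, Or.inr hv, hp⟩

/-- **MatchBOpen holds for every domain.** [cite: BollobasRiordan2006, Ch. 7 Lemma 5 pp. 169–171] -/
theorem matchBOpen_holds : MatchBOpen D := by
  intro σ r hB
  rcases walk_dichotomy D σ r with ⟨hA, -⟩ | ⟨-, hO⟩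
  · exact absurd ⟨hA, hB⟩ (loopUnique_holds D σ r false)
  · exact (isOpenCrossing_forget D σ r).1 hO

/-- **MatchAClosed holds for every domain.** [cite: BollobasRiordan2006, Ch. 7 Lemma 5 pp. 169–171] -/
theorem matchAClosed_holds : MatchAClosed D := by
  intro σ r hA
  rcases walk_dichotomy D σ r with ⟨-, hC⟩ | ⟨hB, -⟩
  · exact (isClosedCrossing_forget D σ r).1 hC
  · exact absurd ⟨hA, hB⟩ (loopUnique_holds D σ r false)

/-! ### THE (v-c) FIVE-MARKED LOOP LEMMA, for every five-marked discrete domain -/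

/-- **(v-c) «FIVE-MARKED LOOP LEMMA» for EVERY `D : TriMarkedDomain 5`** (Khristoforov–Smirnov 2021, §1.2 Lemma 2, per
corner, in the Bollobás–Riordan vocabulary; D1-v2 events): exactly one of the link patterns A = [y_{r+1} ↔ y_{r+2}],
B = [y_{r+1} ↔ y_{r+4}] occurs; B iff an open crossing `A_{r+1} ↔ A_{r+3}`, A iff a closed crossing
`A_{r+2} → A_{r+4} ∪ A_r`. All four inputs of the skeleton's `loop5_of_stubs` are theorems above. [cite: KhristoforovSmirnov2021, §1.2 Lemma 2 (p. 4)] -/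
theorem fiveMarkedLoopLemma_holds : FiveMarkedLoopLemma D :=
  loop5_of_stubs D (loopReach_holds D) (loopUnique_holds D) (matchBOpen_holds D) (matchAClosed_holds D)

/-- the `c = true` twin, for every domain. [cite: KhristoforovSmirnov2021, §1.2 Lemma 2 (p. 4)] -/
theorem fiveMarkedLoopLemma'_holds : FiveMarkedLoopLemma' D :=
  loop5'_of_loop5 D (fiveMarkedLoopLemma_holds D)

/-- the finite form (the RUNG's face) for every domain — in particular for `hexBall1Five`, `hexBall2Five`. [cite: KhristoforovSmirnov2021, §1.2 Lemma 2 (p. 4)] -/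
theorem fiveMarkedLoopLemmaFin_holds : FiveMarkedLoopLemmaFin D :=
  fin_of_loop5 D (fiveMarkedLoopLemma_holds D)


end Literature.Probability.Percolation.FivePoint
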